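/-
Copyright (c) 2026. All rights reserved.
Released under Apache 2.0 license as described in the file LICENSE.
Authors: abc-iut cell, seat abc-iut-f-086 (F fact-proving wave; FACT-LIST rows F-0388, F-0389).
-/
import Mathlib.CategoryTheory.SingleObj
import Mathlib.CategoryTheory.PUnit
import Mathlib.Algebra.Group.Nat.TypeTags
import Literature.AnabelianGeometry.AbsoluteAnabelian.AbsTopIII.MonoAnabelianComparisonMLF
import Literature.AnabelianGeometry.AbsoluteAnabelian.AbsTopIII.MonoAnabelianComparisonShapes
import Literature.AnabelianGeometry.AbsoluteAnabelian.AbsTopIII.BiAnabelianModelProofs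
import HarnessLib

/-!
# [AbsTopIII] Corollary 3.7 (iv)/(v): the predicates `BiAnabelianSetting.LogCoreKernel` and
# `Cor37Vertex.AboveBox` — kernel records (FACT-LIST rows F-0388, F-0389)

S. Mochizuki, *Topics in absolute anabelian geometry III* [MochizukiAbsTopIII2015] (kurims manuscript
`paper:url-5493eb38cbb7`), Cor 3.7 pp. 86–88: item (iv) p. 88 ("The diagram of categories `𝒟†_{≤2}`
does not admit a structure of core on `𝒟†_{≤1}` which [...] is compatible with [...] the observable
`𝔖†_log`"; proof "entirely similar" to Cor 3.6 (iv) p. 81: "by writing out explicitly the meaning of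
such an equality `ζ'₁ = ζ₂`, we conclude that we obtain a contradiction to Lemma 3.4"), and item (v)
p. 88 ("The vertex `□` of the second row of `𝒟*` is a nexus of `Γ⃗_{𝒟*}`").

PROOF-ONLY companion of `MonoAnabelianComparisonMLF.lean` / `MonoAnabelianComparisonShapes.lean`
(abc-iut-L4-t9, p406791 / p405288) for the two `def … : Prop` declarations of those files that the
FROZEN plan/FACT-LIST.md lists as rows F-0388 and F-0389 (`kernel_closedness = parametrised`).
Both are PARAMETRISED PREDICATES, not facts; this file records what the kernel can say about them.

## F-0388 `BiAnabelianSetting.LogCoreKernel 𝔖` (Cor 3.7 (iv), the auxiliary kernel statement)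

"there is a natural isomorphism `ζ : 𝟭_𝒳 ⥲ log` with `λ^×(ζ_A) ≫ ι_{log,A} = ι_{×,A}` for all `A`" —
the identity that a core structure of `𝒟†_{≤2}` on `𝒟†_{≤1}` compatible with `𝔖†_log` would force;
its own docstring says "Cor 3.7 (iv) says this FAILS for the MLF setting (via Lemma 3.4); for an
abstract setting it is just a `Prop`".  Recorded here:

* `not_logCoreKernel_of_logKernelObstruction` — for EVERY setting, the component-level Lemma-3.4
  obstruction (`LogKernelObstruction`, abc-iut-L4-t9, the hypothesis through which the tree's
  discharges `incompatibleStmt_of_obstruction` / `cor_3_7_iv_of_obstruction` consume Lemma 3.4)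
  REFUTES the kernel statement (evaluate `ζ` at the obstructed object `x₀`);
* `TFModel.modelSetting_not_logCoreKernel` — **the printed content at the MLF MODEL**: for the
  model setting `TFModel.modelSetting p` (MLF-Galois `TF`-pairs on `ℚ̄_p`, the real `λ^×, λ^{×pf},
  ι_log, ι_×`) the kernel statement is FALSE, by abc-iut-L4-t9's `modelSetting_logKernelObstruction`
  (Lemma 3.4: `ι_×(p) = [p] ∉ (𝒪^×_k̄)^pf`); likewise in any log-coordinates
  (`modelSetting_rebaseLog_not_logCoreKernel`, `logCoreKernel_rebaseLog_iff`);
* hence the universal closure of the row is REFUTED (`not_forall_logCoreKernel`), while the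
  predicate is satisfiable on a toy setting with `ι_log = ι_×` (`exists_logCoreKernel`) — a
  two-sided schema, admissible only per instance (plan R1/R5), and at the instance the cone cares
  about (the MLF model) its NEGATION is the theorem.

## F-0389 `Cor37Vertex.AboveBox a := 3 ≤ a.row` (Cor 3.7 (v), the post-nexus side `Γ⃗_{>□}`)

A decidable predicate on the five-constructor vertex type of `Γ⃗_{𝒟*}`; recorded: its complete truth
table (`aboveBox_iff : a.AboveBox ↔ a = space ∨ a = galois`, the five evaluations), stability under
the `ℤ`-translation and under outgoing edges, the refutation of its universal closure
(`not_forall_aboveBox`, at `□` itself) and non-vacuity.  The instance forms used by the trunk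
(`space.AboveBox`, `(first 0).BelowBox`) are already proved there (`belowBox_aboveBox_partition`);
the companion predicate `BelowBox` (row F-0390) is recorded by the sibling file
`MonoAnabelianComparisonShapesMembershipProofs.lean` (p427840) and is not repeated here.

Refereed pre-IUT anabelian geometry; nothing in this file bears on [IUTchIII] Cor. 3.12; no side
taken; typed ≠ proved except for the theorems below.
-/

set_option autoImplicit false

namespace Literature.AnabelianGeometry.AbsoluteAnabelian.AbsTopIII

open CategoryTheory

/-! ## F-0388: the kernel statement `LogCoreKernel` -/

namespace BiAnabelianSetting

section General

universe v₁ v₂ v₃ u₁ u₂ u₃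

variable {X : Type u₁} [Category.{v₁} X] {E : Type u₂} [Category.{v₂} E] {N : Type u₃}
  [Category.{v₃} N] (𝔖 : BiAnabelianSetting X E N)

/-- Unfolding of the kernel statement: "there is a natural isomorphism `ζ : 𝟭_𝒳 ⥲ log` with
`λ^×(ζ_A) ≫ ι_{log,A} = ι_{×,A}` for all `A`". [cite: MochizukiAbsTopIII2015, Cor 3.7 (iv) p.88] -/
theorem logCoreKernel_iff :
    𝔖.LogCoreKernel ↔ ∃ ζ : 𝟭 X ≅ 𝔖.log, ∀ A : X,
      𝔖.lamTimes.map (ζ.hom.app A) ≫ 𝔖.iotaLog.app A = 𝔖.iotaTimes.app A :=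
  Iff.rfl

/-- Component form: the kernel statement provides, at EVERY object `A` of `𝒳`, an ISOMORPHISM
`a : A ⥲ log A` with `λ^×(a) ≫ ι_{log,A} = ι_{×,A}` — exactly what the Lemma-3.4 obstruction forbids
at its object `x₀`. [cite: MochizukiAbsTopIII2015, Cor 3.7 (iv) p.88] -/
theorem exists_isIso_comp_eq_of_logCoreKernel (h : 𝔖.LogCoreKernel) (A : X) :
    ∃ a : A ⟶ 𝔖.log.obj A, IsIso a ∧
      𝔖.lamTimes.map a ≫ 𝔖.iotaLog.app A = 𝔖.iotaTimes.app A := by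
  obtain ⟨ζ, hζ⟩ := h
  exact ⟨ζ.hom.app A, Iso.isIso_hom (ζ.app A), hζ A⟩

/-- The compatible case: if `ι_×` IS `ι_log` transported along the structure isomorphism
`log ≅ 𝟭` (`ι_{×,A} = λ^×((logIsoId)⁻¹_A) ≫ ι_{log,A}` for all `A`), the kernel statement holds with
`ζ = logIsoId⁻¹`. [cite: MochizukiAbsTopIII2015, Cor 3.7 (iv) p.88] -/
theorem logCoreKernel_of_iotaTimes_eq
    (h : ∀ A : X, 𝔖.lamTimes.map (𝔖.logIsoId.inv.app A) ≫ 𝔖.iotaLog.app A = 𝔖.iotaTimes.app A) :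
    𝔖.LogCoreKernel :=
  ⟨𝔖.logIsoId.symm, h⟩

end General

section Obstruction

universe u

variable {X E N : Type u} [Category.{u} X] [Category.{u} E] [Category.{u} N]
  (𝔖 : BiAnabelianSetting X E N)

/-- **The Lemma-3.4 obstruction refutes the kernel statement** (every setting): if at some `x₀` no
isomorphism `a : x₀ ⥲ log x₀` has `λ^×(a) ≫ ι_{log,x₀} = ι_{×,x₀}` (`LogKernelObstruction`), then there
is no natural `ζ : 𝟭 ⥲ log` with `λ^×(ζ) ≫ ι_log = ι_×` — evaluate at `x₀`.  This is the sentence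
"Cor 3.7 (iv) says this FAILS" of the trunk docstring, reduced to its printed input.
[cite: MochizukiAbsTopIII2015, Cor 3.7 (iv) p.88] -/
theorem not_logCoreKernel_of_logKernelObstruction (hobs : 𝔖.LogKernelObstruction) :
    ¬ 𝔖.LogCoreKernel := by
  rintro ⟨ζ, hζ⟩
  obtain ⟨x₀, hx₀⟩ := hobs
  exact hx₀ (ζ.hom.app x₀) (Iso.isIso_hom (ζ.app x₀)) (hζ x₀)

/-- Contrapositive: a setting satisfying the kernel statement carries no Lemma-3.4 obstruction.
[cite: MochizukiAbsTopIII2015, Cor 3.7 (iv) p.88] -/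
theorem not_logKernelObstruction_of_logCoreKernel (h : 𝔖.LogCoreKernel) :
    ¬ 𝔖.LogKernelObstruction :=
  fun hobs => 𝔖.not_logCoreKernel_of_logKernelObstruction hobs h

/-- **Change of log-coordinates does not affect the kernel statement**: for `e : log' ≅ log`, the
rebased setting (abc-iut-L4-t9's `rebaseLog`: `log'`, `ι_log` transported along `e`) satisfies
`LogCoreKernel` iff the original one does (`ζ' ↦ ζ' ≫ e`). Companion of
`logKernelObstruction_rebaseLog_iff`. [cite: MochizukiAbsTopIII2015, Definition 3.1 (iv) p.69] -/
theorem logCoreKernel_rebaseLog_iff (log' : X ⥤ X) (e : log' ≅ 𝔖.log) :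
    (𝔖.rebaseLog log' e).LogCoreKernel ↔ 𝔖.LogCoreKernel := by
  constructor
  · rintro ⟨ζ', hζ'⟩
    refine ⟨ζ' ≪≫ e, fun A => ?_⟩
    have h := hζ' A
    rw [rebaseLog_iotaLog_app] at h
    change 𝔖.lamTimes.map (ζ'.hom.app A) ≫ 𝔖.lamTimes.map (e.hom.app A) ≫ 𝔖.iotaLog.app A =
      𝔖.iotaTimes.app A at h
    rw [Iso.trans_hom, NatTrans.comp_app, Functor.map_comp, Category.assoc]
    exact h
  · rintro ⟨ζ, hζ⟩
    refine ⟨ζ ≪≫ e.symm, fun A => ?_⟩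
    rw [rebaseLog_iotaLog_app]
    change 𝔖.lamTimes.map ((ζ ≪≫ e.symm).hom.app A) ≫ 𝔖.lamTimes.map (e.hom.app A) ≫
      𝔖.iotaLog.app A = 𝔖.iotaTimes.app A
    rw [Iso.trans_hom, Iso.symm_hom, NatTrans.comp_app, Functor.map_comp, Category.assoc,
      ← 𝔖.lamTimes.map_comp_assoc (e.inv.app A) (e.hom.app A), Iso.inv_hom_id_app,
      CategoryTheory.Functor.map_id, Category.id_comp]
    exact hζ A

end Obstruction

end BiAnabelianSetting

/-! ### F-0388 at the MLF model: the kernel statement is FALSE (Cor 3.7 (iv) via Lemma 3.4) -/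

namespace TFModel

variable (p : ℕ) [Fact p.Prime]

/-- **Cor 3.7 (iv), kernel statement, at the MLF MODEL**: for the model setting
`TFModel.modelSetting p` (MLF-Galois `TF`-pairs of residue characteristic `p` on `ℚ̄_p`; the real
`λ^×`, `λ^{×pf}`, `ι_log`, `ι_×`) there is NO natural `ζ : 𝟭 ⥲ log` with `λ^×(ζ) ≫ ι_log = ι_×` —
from the Lemma-3.4 obstruction at the model (`modelSetting_logKernelObstruction`, abc-iut-L4-t9:
`ι_×(p) = [p] ∉ (𝒪^×_k̄)^pf`). [cite: MochizukiAbsTopIII2015, Cor 3.7 (iv) p.88] -/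
theorem modelSetting_not_logCoreKernel :
    ¬ Literature.AnabelianGeometry.AbsoluteAnabelian.AbsTopIII.BiAnabelianSetting.LogCoreKernel
      (TFModel.modelSetting p) :=
  (TFModel.modelSetting p).not_logCoreKernel_of_logKernelObstruction
    (modelSetting_logKernelObstruction p)

/-- The same in ANY log-coordinates of the model (log-Frobenius functor `log' ≅ 𝟭`, `ι_log`
transported). [cite: MochizukiAbsTopIII2015, Cor 3.7 (iv) p.88] -/
theorem modelSetting_rebaseLog_not_logCoreKernel (log' : TFModel p ⥤ TFModel p)
    (e : log' ≅ 𝟭 (TFModel p)) :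
    ¬ Literature.AnabelianGeometry.AbsoluteAnabelian.AbsTopIII.BiAnabelianSetting.LogCoreKernel
      ((TFModel.modelSetting p).rebaseLog log' e) :=
  ((TFModel.modelSetting p).rebaseLog log' e).not_logCoreKernel_of_logKernelObstruction
    (modelSetting_rebaseLog_logKernelObstruction p log' e)

end TFModel

/-! ### F-0388: the universal closure is refuted; the predicate is satisfiable (two-sided schema) -/

/-- **The universal closure of `LogCoreKernel` is REFUTED** — witnessed by the MLF model setting at
`p = 2` (universe `1`, where the model lives).  So F-0388 is never a hypothesis
`∀ 𝔖, 𝔖.LogCoreKernel`; at the model its negation is a theorem.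
[cite: MochizukiAbsTopIII2015, Cor 3.7 (iv) p.88] -/
theorem not_forall_logCoreKernel :
    ¬ ∀ (X E N : Type 1) [Category.{1} X] [Category.{1} E] [Category.{1} N]
        (𝔖 : BiAnabelianSetting X E N), 𝔖.LogCoreKernel :=
  fun h => TFModel.modelSetting_not_logCoreKernel 2 (h _ _ _ (TFModel.modelSetting 2))

/-- A small-universe refutation isolating the mechanism: on the toy setting of
`BiAnabelianAssembly` (`𝒳 = 𝔈` the one-object discrete category, `log = 𝟭`, `𝒩` the one-object
category of `(ℕ, +)`, `λ^× = λ^{×pf}` constant, `ι_log = 1`, `ι_× = 2`) the kernel statement fails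
(`λ^×(ζ) = 0`, and `0 + 1 ≠ 2`), while with `ι_× = 1` instead it holds (`ζ = id`): the row is a
genuine two-sided schema already in universe `0`. [cite: MochizukiAbsTopIII2015, Cor 3.7 (iv) p.88] -/
theorem exists_logCoreKernel_and_exists_not :
    (∃ (X E N : Type) (_ : Category.{0} X) (_ : Category.{0} E) (_ : Category.{0} N)
        (𝔖 : BiAnabelianSetting X E N), 𝔖.LogCoreKernel) ∧
      ∃ (X E N : Type) (_ : Category.{0} X) (_ : Category.{0} E) (_ : Category.{0} N)
        (𝔖 : BiAnabelianSetting X E N), ¬ 𝔖.LogCoreKernel := by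
  let L : Discrete PUnit.{1} ⥤ SingleObj (Multiplicative ℕ) :=
    (Functor.const (Discrete PUnit.{1})).obj (SingleObj.star _)
  let one : 𝟭 (Discrete PUnit.{1}) ⋙ L ⟶ L :=
    Discrete.natTrans fun _ => (Multiplicative.ofAdd (1 : ℕ) : Multiplicative ℕ)
  let one' : L ⟶ L := Discrete.natTrans fun _ => (Multiplicative.ofAdd (1 : ℕ) : Multiplicative ℕ)
  let two : L ⟶ L := Discrete.natTrans fun _ => (Multiplicative.ofAdd (2 : ℕ) : Multiplicative ℕ)
  -- `ι_log = ι_× = 1`: the kernel statement holds with `ζ = id`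
  let 𝔖₁ : BiAnabelianSetting (Discrete PUnit.{1}) (Discrete PUnit.{1})
      (SingleObj (Multiplicative ℕ)) :=
    { gal := 𝟭 _, log := 𝟭 _, logIsoId := Iso.refl _,
      lamTimes := L, lamTimesPf := L, iotaLog := one, iotaTimes := one',
      spaceGal := (Functor.const (SingleObj (Multiplicative ℕ))).obj ⟨PUnit.unit⟩,
      lamTimesGal := Functor.punitExt _ _, lamTimesPfGal := Functor.punitExt _ _ }
  -- `ι_log = 1`, `ι_× = 2`: the kernel statement fails
  let 𝔖₂ : BiAnabelianSetting (Discrete PUnit.{1}) (Discrete PUnit.{1})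
      (SingleObj (Multiplicative ℕ)) :=
    { 𝔖₁ with iotaTimes := two }
  refine ⟨⟨_, _, _, inferInstance, inferInstance, inferInstance, 𝔖₁, ⟨Iso.refl _, fun A => ?_⟩⟩,
    ⟨_, _, _, inferInstance, inferInstance, inferInstance, 𝔖₂, ?_⟩⟩
  · simp [𝔖₁, L, one, one', SingleObj.comp_as_mul, SingleObj.id_as_one, Discrete.natTrans]
  · rintro ⟨ζ, hζ⟩
    have h := hζ ⟨PUnit.unit⟩
    simp [𝔖₂, 𝔖₁, L, one, two, SingleObj.comp_as_mul, SingleObj.id_as_one, Discrete.natTrans] at h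

/-! ## F-0389: the post-nexus side `AboveBox` — complete truth table -/

namespace Cor37Vertex

universe w

/-- Unfolding: `a ∈ Γ⃗_{>□}` iff `a` lies in rows 3–4. [cite: MochizukiAbsTopIII2015, Cor 3.7 (v) p.88] -/
theorem aboveBox_iff_le_row (a : Cor37Vertex) : a.AboveBox ↔ 3 ≤ a.row :=
  Iff.rfl

/-- **Truth table of `AboveBox`**: the post-nexus side `Γ⃗_{>□}` of `Γ⃗_{𝒟*}` consists exactly of the
third-row vertex (`𝒩`) and the fourth-row vertex (`𝔈`). [cite: MochizukiAbsTopIII2015, Cor 3.7 (v) p.88] -/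
theorem aboveBox_iff (a : Cor37Vertex) : a.AboveBox ↔ a = space ∨ a = galois := by
  cases a <;> simp [AboveBox, row]

/-- `𝒩` lies above the nexus. [cite: MochizukiAbsTopIII2015, Cor 3.7 (v) p.88] -/
theorem aboveBox_space : space.AboveBox :=
  belowBox_aboveBox_partition.2.2.2

/-- `𝔈` lies above the nexus. [cite: MochizukiAbsTopIII2015, Cor 3.7 (v) p.88] -/
theorem aboveBox_galois : galois.AboveBox :=
  (aboveBox_iff galois).2 (Or.inr rfl)

/-- The nexus `□` itself is not above the nexus. [cite: MochizukiAbsTopIII2015, Cor 3.7 (v) p.88] -/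
theorem not_aboveBox_box : ¬ box.AboveBox := by
  simp [aboveBox_iff]

/-- No first-row vertex `⋎` is above the nexus. [cite: MochizukiAbsTopIII2015, Cor 3.7 (v) p.88] -/
theorem not_aboveBox_first (n : ℤ) : ¬ (first n).AboveBox := by
  simp [aboveBox_iff]

/-- The core vertex `ref` (first row of `𝒟‡`) is not above the nexus.
[cite: MochizukiAbsTopIII2015, Cor 3.7 (v) p.88] -/
theorem not_aboveBox_ref : ¬ ref.AboveBox := by
  simp [aboveBox_iff]

/-- The two sides of the nexus are disjoint (pointwise form of `belowBox_aboveBox_partition`).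
[cite: MochizukiAbsTopIII2015, Cor 3.7 (v) p.88] -/
theorem not_belowBox_of_aboveBox {a : Cor37Vertex} (h : a.AboveBox) : ¬ a.BelowBox :=
  fun hb => belowBox_aboveBox_partition.2.1 a ⟨hb, h⟩

/-- A vertex above the nexus is not the nexus. [cite: MochizukiAbsTopIII2015, Cor 3.7 (v) p.88] -/
theorem ne_box_of_aboveBox {a : Cor37Vertex} (h : a.AboveBox) : a ≠ box :=
  (belowBox_aboveBox_partition.1 a).2 (Or.inr h)

/-- The `ℤ`-translation of Cor 3.7 (v) preserves the post-nexus side (it fixes rows ≥ 2).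
[cite: MochizukiAbsTopIII2015, Cor 3.7 (v) p.88] -/
theorem aboveBox_shiftObj_iff (k : ℤ) (a : Cor37Vertex) : (shiftObj k a).AboveBox ↔ a.AboveBox := by
  rw [aboveBox_iff_le_row, aboveBox_iff_le_row, shiftObj_row]

/-- `Γ⃗_{>□}` is closed under outgoing edges of `Γ⃗_{𝒟*}` (nexus condition (b): no edge leaves rows
3–4). [cite: MochizukiAbsTopIII2015, Cor 3.7 (v) p.88] -/
theorem aboveBox_of_edge {a b : Cor37Vertex} (e : Cor37Edge.{w} a b) (ha : a.AboveBox) :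
    b.AboveBox :=
  Nat.le_trans ha (Cor37Edge.row_monotone e)

/-- `Γ⃗_{<□}` is closed under incoming edges of `Γ⃗_{𝒟*}` (no edge enters row 1 from outside).
[cite: MochizukiAbsTopIII2015, Cor 3.7 (v) p.88] -/
theorem belowBox_of_edge {a b : Cor37Vertex} (e : Cor37Edge.{w} a b) (hb : b.BelowBox) :
    a.BelowBox := by
  rcases Cor37Edge.box_nexus e with ⟨ha, -⟩ | ⟨-, hb'⟩ | ⟨ha, -⟩ | ⟨-, hb'⟩
  · exact ha
  · exact absurd hb (not_belowBox_of_aboveBox hb')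
  · exact ha
  · exact absurd hb (not_belowBox_of_aboveBox hb')

/-- **The universal closure of `AboveBox` is REFUTED** (the nexus `□` is not above itself): F-0389
is a per-vertex predicate, never a hypothesis `∀ a, a.AboveBox`.
[cite: MochizukiAbsTopIII2015, Cor 3.7 (v) p.88] -/
theorem not_forall_aboveBox : ¬ ∀ a : Cor37Vertex, a.AboveBox :=
  fun h => not_aboveBox_box (h box)

/-- … and the predicate is satisfiable (`𝒩`) and refutable (`□`): a two-sided schema whose every
instance is decided by `aboveBox_iff`. [cite: MochizukiAbsTopIII2015, Cor 3.7 (v) p.88] -/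
theorem exists_aboveBox_and_exists_not :
    (∃ a : Cor37Vertex, a.AboveBox) ∧ ∃ a : Cor37Vertex, ¬ a.AboveBox :=
  ⟨⟨space, aboveBox_space⟩, ⟨box, not_aboveBox_box⟩⟩

end Cor37Vertex

end Literature.AnabelianGeometry.AbsoluteAnabelian.AbsTopIII
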